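import Literature.NumberTheory.Automorphic.CongruenceSubgroupPropertySL2MennickeOfSL2
import Literature.NumberTheory.Automorphic.CongruenceSubgroupPropertySL2MennickeTrivial
import HarnessLib

/-!
# Serre's congruence subgroup property for `SL₂(𝓞_F)` — proofs, XX (final): the theorem

Topic `Literature/NumberTheory/Automorphic`; namespace `Literature.NumberTheory.Automorphic`
(sub-namespace `SL2Rel` for the relative-group statements).  Everything here is PROVED; no
definitions, no named facts.  This file discharges the tree's named fact
`SerreSL2Congruence1970_congruenceSubgroupProperty` (`…_holds`), assembling files I–XIX:

* `SL2Rel.sym_eq_one_of_row` — **Vaserstein's Lemma 3 + Bass–Milnor–Serre Thm. 3.6**: for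
  `A = 𝓞 K`, `K` a number field with a real place and a unit of infinite order, and a principal
  ideal `𝔮 = (q) ≠ 0`, the symbol `[b over a] ∈ G(𝔮, A) ⧸ ncl E(𝔮, A)` of Liehl §3 (file XIV) is a
  Mennicke symbol on `W_𝔮` (MS1 = Liehl's (6), file XIV; MS2 = Liehl's (7), file XIX), hence trivial
  by BMS Thm. 3.6 (`SerreSL2.MennickeSymbol.sym_eq_one`, file VI);
* `SL2Rel.relG_le_relE_span_singleton` — **Vaserstein's Theorem** (Mat. Sb. 89 (1972), p. 313,
  "`G(I₁, I₂) = E(I₁, I₂)`") for the pair `((q), A)`: `G((q), A) ≤ E((q), A)` (the class of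
  `α ∈ G(𝔮, A)` is the symbol of its first row, and classes are computed modulo `E(𝔮, A)` by (5),
  `mk_eq_mk_iff`, file XVIII);
* `exists_isReal_of_isTotallyReal`, `exists_unit_pow_ne_one` — the two standing hypotheses of files
  IX–XIX for a totally real field of degree `≥ 2` (a real place; a unit of infinite order, from
  Mathlib's proof of Dirichlet's unit theorem `NumberField.Units.dirichletUnitTheorem.exists_unit`
  and `NumberField.Units.mem_torsion`, using that `F` has two distinct infinite places);
* `SerreSL2Congruence1970_congruenceSubgroupProperty_holds` — **Serre 1970, §2.6 Théorème 2 (b) with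
  Corollaire 3** for `SL₂(𝓞_F)`, `F` totally real, `[F:ℚ] ≥ 2`: every subgroup of finite index is a
  congruence subgroup; by the reduction `congruenceSubgroupProperty_of_relG_le_relE` (file I:
  Serre's Prop. 1 and `Γ(𝔪) ∩ E(𝔪, A) ≤ Ê_𝔪`) applied to `𝔮 = (e)`, `e = [SL₂(𝓞_F) : core H]`.

## References

* [SerreSL2Congruence1970] J.-P. Serre, *Le problème des groupes de congruence pour SL₂*, Ann. of
  Math. (2) 92 (1970) 489–527, §1.4 Prop. 1, §2.6 Thm. 2, Cor. 3.
* [Vaserstein1972SL2] L. N. Vaserstein, Mat. Sb. 89 (131) (1972) 313–322, Theorem and Lemma 3.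
* [BassMilnorSerre1967] H. Bass, J. Milnor, J.-P. Serre, Publ. Math. IHES 33 (1967), Ch. I
  Def. 2.5, Thm. 3.6.
* [Liehl1981SL2Orders] B. Liehl, J. reine angew. Math. 323 (1981) 153–171, §3 (5)–(7).
-/

open Matrix MatrixGroups NumberField

namespace Literature.NumberTheory.Automorphic

namespace SL2Rel

section NumberField

variable {K : Type} [Field K] [NumberField K]

/-- **Vaserstein's Lemma 3 + BMS Thm. 3.6**: for `𝔮 = (q) ≠ 0` in `A = 𝓞 K` (`K` with a real place
and a unit of infinite order) the symbol `[b over a] ∈ G(𝔮, A) ⧸ ncl E(𝔮, A)` is a Mennicke symbol on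
`W_𝔮` (MS1 = Liehl (6), MS2 = Liehl (7)), hence trivial: `[b over a] = 1` for all `(a, b) ∈ W_𝔮`.
[cite: Vaserstein1972SL2, Lemma 3; BassMilnorSerre1967, Ch. I Thm. 3.6] -/
theorem sym_eq_one_of_row (hreal : ∃ w : InfinitePlace K, w.IsReal)
    (hunit : ∃ v : (𝓞 K)ˣ, ∀ n : ℕ, n ≠ 0 → v ^ n ≠ 1) {q : 𝓞 K} (hq : q ≠ 0) {a b : 𝓞 K}
    (ha : a - 1 ∈ Ideal.span {q}) (hb : b ∈ Ideal.span {q}) (hab : IsCoprime a b) :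
    sym (Ideal.span {q}) a b = 1 := by
  have h𝔮 : Ideal.span {q} ≠ (⊥ : Ideal (𝓞 K)) := by
    rwa [Ne, Ideal.span_singleton_eq_bot]
  obtain ⟨w, hw⟩ : ∃ w : InfinitePlace K, w.IsReal := id hreal
  -- the symbol packaged as a Mennicke symbol on `W_𝔮` (BMS Def. 2.5)
  let M : SerreSL2.MennickeSymbol (Ideal.span {q}) (SymbGroup (Ideal.span {q})) :=
    { sym := sym (Ideal.span {q})
      sym_one_zero := sym_one_zero _
      ms1_right := fun _ _ _ ha hb hab ht ↦ sym_add_mul_right ha hb hab ht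
      ms1_left := fun _ _ t ha hb hab ↦ sym_add_mul_left ha hb hab t
      ms2 := fun _ _ _ ha hb₁ hb₂ h₁ h₂ ↦ sym_mul_right hreal hunit h𝔮 ha hb₁ hb₂ h₁ h₂ }
  exact M.sym_eq_one (InfinitePlace.embedding_of_isReal hw) ha hb hab

/-- **Vaserstein's Theorem** (`G(I₁, I₂) = E(I₁, I₂)`) for the pair `((q), A)`, `A = 𝓞 K`, `K` a
number field with a real place and a unit of infinite order, `q ≠ 0`: `G((q), A) ≤ E((q), A)` — the
class of `α ∈ G(𝔮, A)` in `G(𝔮, A) ⧸ ncl E(𝔮, A)` is the (trivial) symbol of its first row, and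
`ncl E(𝔮, A) = E(𝔮, A)` by (5). [cite: Vaserstein1972SL2, Theorem, p. 313] -/
theorem relG_le_relE_span_singleton (hreal : ∃ w : InfinitePlace K, w.IsReal)
    (hunit : ∃ v : (𝓞 K)ˣ, ∀ n : ℕ, n ≠ 0 → v ^ n ≠ 1) {q : 𝓞 K} (hq : q ≠ 0) :
    relG (Ideal.span {q}) ⊤ ≤ relE (Ideal.span {q}) (⊤ : Ideal (𝓞 K)) := by
  intro A hA
  have h𝔮 : Ideal.span {q} ≠ (⊥ : Ideal (𝓞 K)) := by
    rwa [Ne, Ideal.span_singleton_eq_bot]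
  obtain ⟨h01, -, h00, -⟩ := mem_relG.1 hA
  rw [Ideal.mul_top] at h00
  have hab : IsCoprime (A 0 0) (A 0 1) := by
    refine ⟨A 1 1, -A 1 0, ?_⟩
    have hdet := Matrix.det_fin_two (A : Matrix (Fin 2) (Fin 2) (𝓞 K))
    rw [A.det_coe] at hdet
    linear_combination -hdet
  set α : relG (Ideal.span {q}) ⊤ := ⟨A, hA⟩ with hα
  have hsym : sym (Ideal.span {q}) (A 0 0) (A 0 1) = (α : SymbGroup (Ideal.span {q})) :=
    sym_eq_mk α rfl rfl
  have h1 : (α : SymbGroup (Ideal.span {q})) = ((1 : relG (Ideal.span {q}) ⊤) : SymbGroup _) := by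
    rw [← hsym, sym_eq_one_of_row hreal hunit hq h00 h01 hab, QuotientGroup.mk_one]
  rw [mk_eq_mk_iff hreal hunit h𝔮] at h1
  simpa [hα] using h1

end NumberField

end SL2Rel

/-! ### The standing hypotheses for a totally real field of degree `≥ 2` -/

/-- A totally real number field has a real place. [folklore] -/
theorem exists_isReal_of_isTotallyReal (F : Type*) [Field F] [NumberField F]
    [NumberField.IsTotallyReal F] : ∃ w : InfinitePlace F, w.IsReal :=
  ⟨Classical.arbitrary _, NumberField.IsTotallyReal.isReal _⟩

/-- A number field with two distinct infinite places has a unit of infinite order (the unit attached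
to one of them by Mathlib's proof of Dirichlet's unit theorem is `< 1` at the other, so it is not a
root of unity). [folklore] -/
theorem exists_unit_pow_ne_one_of_ne {F : Type*} [Field F] [NumberField F]
    {w₁ w₂ : InfinitePlace F} (hne : w₁ ≠ w₂) :
    ∃ v : (𝓞 F)ˣ, ∀ n : ℕ, n ≠ 0 → v ^ n ≠ 1 := by
  obtain ⟨u, hu⟩ := NumberField.Units.dirichletUnitTheorem.exists_unit F w₁
  refine ⟨u, fun n hn h ↦ ?_⟩
  have htors : u ∈ NumberField.Units.torsion F := by
    rw [NumberField.Units.torsion, CommGroup.mem_torsion, isOfFinOrder_iff_pow_eq_one]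
    exact ⟨n, Nat.pos_of_ne_zero hn, h⟩
  have h1 : w₂ ((u : 𝓞 F) : F) = 1 := (NumberField.Units.mem_torsion F).1 htors w₂
  have hlt := hu w₂ hne.symm
  rw [h1, Real.log_one] at hlt
  exact lt_irrefl _ hlt

/-- A totally real number field of degree `≥ 2` has a unit of infinite order (it has `[F:ℚ] ≥ 2`
infinite places). [folklore] -/
theorem exists_unit_pow_ne_one (F : Type*) [Field F] [NumberField F] [NumberField.IsTotallyReal F]
    (hd : 1 < Module.finrank ℚ F) : ∃ v : (𝓞 F)ˣ, ∀ n : ℕ, n ≠ 0 → v ^ n ≠ 1 := by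
  classical
  have hcard : 1 < Fintype.card (InfinitePlace F) := by
    rw [NumberField.InfinitePlace.card_eq_nrRealPlaces_add_nrComplexPlaces,
      ← NumberField.IsTotallyReal.finrank]
    omega
  obtain ⟨w₁, w₂, hne⟩ := Fintype.one_lt_card_iff.1 hcard
  exact exists_unit_pow_ne_one_of_ne hne

/-- **Serre 1970, §2.6 Théorème 2 (b) and Corollaire 3 — the congruence subgroup property of
`SL₂(𝓞_F)` for `F` totally real of degree `≥ 2`**: every subgroup of finite index of `SL₂(𝓞_F)`
contains a principal congruence subgroup `Γ(𝔪)`, `𝔪 ≠ 0`.  Moore-free proof: Vaserstein's theorem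
`G(𝔮, A) = E(𝔮, A)` (files VII–XIX, with the arithmetic of Bass–Milnor–Serre Ch. I and Serre's
Lemme 3) fed into Serre's Prop. 1 (file I). This discharges the named fact
`SerreSL2Congruence1970_congruenceSubgroupProperty`.
[cite: SerreSL2Congruence1970, §2.6 Thm. 2 (b), Cor. 3; Vaserstein1972SL2, Theorem] -/
theorem SerreSL2Congruence1970_congruenceSubgroupProperty_holds :
    SerreSL2Congruence1970_congruenceSubgroupProperty :=
  congruenceSubgroupProperty_of_relG_le_relE fun F _ _ _ hd e he ↦
    SL2Rel.relG_le_relE_span_singleton (exists_isReal_of_isTotallyReal F)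
      (exists_unit_pow_ne_one F hd) (by exact_mod_cast he)

end Literature.NumberTheory.Automorphic
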